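import Literature.MathematicalPhysics.QuantumLattice.DWaveOrderParameterTPrimeCells
import Literature.MathematicalPhysics.QuantumLattice.DWaveSymmetricGroundStateLRO
import Literature.MathematicalPhysics.QuantumLattice.HubbardTTPrimeAnchorWordBoxTransport
import HarnessLib

/-!
# Cap-CLASS transport along `t'` (and upward in `U`) for the `d`-wave pair-sourced `t–t'` Hubbard model:
# a certificate whose class sentence is «every translation-invariant (density-`n`) state with SOURCED energy
# `≤ u` at the anchor `(t'₀, U₀, h)` satisfies `P`» speaks about every sourced ground state at every `(t', U)`
# whose tangent read at the anchor stays below `u` — `t'`-BOXES of response / order ceilings from ONE menu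

Topic `Literature/MathematicalPhysics/QuantumLattice` (namespace = path; family `hubbard`). Companion of
`DWaveOrderParameterTPrimeCells.lean` (this seat: the secant route — order-parameter ceilings over `t'`-cells
from certified ENERGY pairs) and the `t'`-twin of the field-direction class transports of the cuprate cell
(`canonicalClass_responseCeiling_of_field_le`, hubbard-cq-obsth-2 and -3). Written from the `t'`-box lane of the fast
cell (`pub/hubbard-fast`, seat hubbard-box-p3) for the pinning-field MENU rows of `pub/hubbard-cq` / `pub/hubbard-obs`,
whose certified class sentence (node shape `hM`, e.g. `cert_pin2_A0menu_…_pairAmpMax_…`,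
`cert_pin1_M1_gbT_T2union_…`) is literally

  `∀ σ, σ.IsTranslationInvariant → σ.density = n → σ.meanEnergy (hubbardTTPrimeSourcedInteraction 1 t'₀ U₀ 0 d h) 1 ≤ u → P σ`

(`d = dWaveFormFactor`; `P σ` = «`√2·Re σ(P₀^d) ≤ M̃`»). THE POINT (the sourced twin of
`HubbardTTPrimeDiagHopTransport` §3–§4 / `HubbardTTPrimeTwoColumnCapTransport`): the sourced mean energy is AFFINE in
the couplings, `E^{src}_{t'₀,U₀,h}(σ) = E^{src}_{t',U,h}(σ) + (t'₀ − t')·K₂(σ) + (U₀ − U)·D(σ)` (§1), so a sourced ground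
state `ω` at `(t', U)` (translation-invariant minimiser in the density-`n` class, or Bratteli–Kishimoto–Robinson
minimiser of the grand-canonical sourced interaction) has anchor energy at most
`CAP(t',U) + (16/π²)|t'₀ − t'| + max(U₀ − U, 0)·n/2` (§2: the filling-free translation-invariant row
`|K₂| ≤ 16/π²` of hubbard-box-p1 and `0 ≤ D ≤ ρ/2`; UPWARD in `U` is free), where `CAP(t',U)` is any certified cap on
the sourced minimum at the target — for the canonical class the CANONICAL source-free table suffices,
`E^{src}_{t',U,h}(ω) ≤ e(1,t',U,n)` (§3: a gauge-invariant torus-limit ground state of the unsourced model has zero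
pair amplitude, Literature form of hubbard-obs-pin-1's `exists_ti_density_meanEnergy_sourced_le`). Hence (§4) the
class sentence at the anchor holds for every such `ω` as soon as `CAP + slack ≤ u`
(`forall_canonicalMinimiser_of_capClass_tPrime[_U]`, interval / cell forms), and a PRICED class sentence
«`f σ ≤ M + κ·(E^{src}_{anchor}(σ) − u₀)` for all TI density-`n` `σ`» (the Lagrangian reading of the same dual
certificate, `κ ≥ 0` the cap row's multiplier) gives `f ω ≤ M + κ·(CAP + slack − u₀)` with no feasibility
condition (`canonicalMinimiser_le_priced_of_capClass_tPrime[_U]`). §5: the grand-canonical class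
(`IsMeanEnergyMinimiser` of `hubbardTTPrimeSourcedInteraction 1 t' U μ d h`, cap = any ceiling on
`dWaveSourceEnergyDensityTT' t' U μ h`). §6: the pair-amplitude specialisations in the menus' `√2·Re σ(P₀^d)` slot.
§7: INTERVAL-FILLING node classes («`σ.density ∈ [n₁,n₂]`») serve the whole `(t', U, n)` material cell from ONE menu
(`forall_canonicalMinimiser_of_capClass_fillingInterval_{tPrime_U,cell}`, priced, pair-amplitude slot). §8: joint
`(t', U)` SLOPE-WORD forms (certified `K₂` / docc words on the target state replace the kinematic constants). §9: the
other direction — a TRIAL-STATE cap certified at the anchor read at the target `t'` (exactly, with the trial state's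
own `K₂`; or kinematically), and the response FLOOR chord at the target from a canonical floor there
(`div_le_pairAmplitude_minimiser_of_canonicalFloor_of_trial_anchorCap`). §10: ROW-FREE double-occupancy caps for low-energy
translation-invariant states (`D ≤ (R + (16/π²)(1+|t'|))/U`, `U`-secant `D ≤ (R − L)/(U − U')`) and the priced `(t', U)` transport of the
ground-state class with them (the downward-`U` price of a cell without any docc row).

HONEST SCOPE: bookkeeping of affinity and two kinematic rows; every cap, class sentence and multiplier is a
hypothesis to be discharged BY NAME by a certified row; the menus of record are run with `u =` the anchor's own
canonical cap (slack `0`), so a `t'`-box needs either a menu re-run at a looser cap `u` or the priced sentence —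
this file is the consumer shape for both. Response / order CEILINGS only; nothing here floors order; no phase
sentence. Everything is PROVED; no definition, no named fact, zero compute, no `sorry`.

## References
* R. B. Israel, *Convexity in the Theory of Lattice Gases* (1979), Thm. I.3.4 (tangent functionals; affinity of
  the mean energy in the interaction). [cite: Israel1979, Thm. I.3.4]
* J. Wang et al., Phys. Rev. X 14 (2024) 031006, §III (a relaxation certificate constrains every state below an
  energy cap; Lagrangian form of the dual bound). [cite: WangEtAl2024, §III]
* O. Bratteli, D. W. Robinson, *OAQSM 2* (1997), §5.2.2 (gauge-invariant states). [cite: BratteliRobinsonII1997, §5.2.2]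
* D. Ruelle, *Statistical Mechanics* (1969), §3.4. [cite: Ruelle1969, §3.4]
* E. H. Lieb, M. Loss, Duke Math. J. 71 (1993) 337, §8 Thm. 8.2. [cite: LiebLoss1993, §8, Theorem 8.2]
-/

noncomputable section

namespace Literature.MathematicalPhysics.QuantumLattice

open _root_.Matrix Finset Set HubbardWave0 Literature.Probability.LatticeModels ThermodynamicLimit _root_.Filter
open scoped _root_.Topology

namespace InfVolFermionState

/-! ### §1 Affinity of the sourced mean energy in `(t', U)` -/

/-- **The sourced mean energy is affine in `(t', U)`**: for every state `σ`, every `t, μ, h` and form factor `g`,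
`E^{src}_{t'₀,U₀}(σ) = E^{src}_{t',U}(σ) + (U₀ − U)·D(σ) + (t'₀ − t')·K₂(σ)`
(`D(σ) = e_{Φ(0,0,1)}(σ)`, `K₂(σ) = e_{Φ(0,1,0)}(σ)`). [cite: Israel1979, Thm. I.3.4] -/
theorem meanEnergy_sourced_affine (σ : InfVolFermionState 2) (t t' U t'₀ U₀ μ : ℝ) (g : Site 2 → ℝ) (h : ℝ) :
    σ.meanEnergy (hubbardTTPrimeSourcedInteraction t t'₀ U₀ μ g h) 1 =
      σ.meanEnergy (hubbardTTPrimeSourcedInteraction t t' U μ g h) 1 +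
        (U₀ - U) * σ.meanEnergy (hubbardTTPrimeFermionInteraction 0 0 1) 1 +
        (t'₀ - t') * σ.meanEnergy (hubbardTTPrimeFermionInteraction 0 1 0) 1 := by
  rw [meanEnergy_hubbardTTPrimeSourced, meanEnergy_hubbardTTPrimeSourced, σ.meanEnergy_hubbardTTPrime_affine t t' U t'₀ U₀]
  ring

/-- **Affinity in `t'` alone**: `E^{src}_{t'₀}(σ) = E^{src}_{t'}(σ) + (t'₀ − t')·K₂(σ)`. [cite: Israel1979, Thm. I.3.4] -/
theorem meanEnergy_sourced_tp_affine (σ : InfVolFermionState 2) (t t' t'₀ U μ : ℝ) (g : Site 2 → ℝ) (h : ℝ) :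
    σ.meanEnergy (hubbardTTPrimeSourcedInteraction t t'₀ U μ g h) 1 =
      σ.meanEnergy (hubbardTTPrimeSourcedInteraction t t' U μ g h) 1 +
        (t'₀ - t') * σ.meanEnergy (hubbardTTPrimeFermionInteraction 0 1 0) 1 := by
  rw [σ.meanEnergy_sourced_affine t t' U t'₀ U μ g h, sub_self, zero_mul, add_zero]

/-! ### §2 The anchor energy of a translation-invariant state: kinematic `16/π²` in `t'`, free upward in `U` -/

/-- **Kinematic anchor energy along `t'`**: for every translation-invariant `σ` (any filling),
`E^{src}_{t'₀}(σ) ≤ E^{src}_{t'}(σ) + (16/π²)|t'₀ − t'|`. [cite: LiebLoss1993, §8, Theorem 8.2] -/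
theorem IsTranslationInvariant.meanEnergy_sourced_anchor_le_kinematic {σ : InfVolFermionState 2}
    (hσ : σ.IsTranslationInvariant) (t t' t'₀ U μ : ℝ) (g : Site 2 → ℝ) (h : ℝ) :
    σ.meanEnergy (hubbardTTPrimeSourcedInteraction t t'₀ U μ g h) 1 ≤
      σ.meanEnergy (hubbardTTPrimeSourcedInteraction t t' U μ g h) 1 + 16 / Real.pi ^ 2 * |t'₀ - t'| := by
  rw [σ.meanEnergy_sourced_tp_affine t t' t'₀ U μ g h]
  have h2 := hσ.abs_meanEnergy_diagHop_le_of_any_density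
  have h4 : (t'₀ - t') * σ.meanEnergy (hubbardTTPrimeFermionInteraction 0 1 0) 1 ≤
      |t'₀ - t'| * |σ.meanEnergy (hubbardTTPrimeFermionInteraction 0 1 0) 1| := by
    rw [← abs_mul]
    exact le_abs_self _
  have h5 : |t'₀ - t'| * |σ.meanEnergy (hubbardTTPrimeFermionInteraction 0 1 0) 1| ≤
      |t'₀ - t'| * (16 / Real.pi ^ 2) := mul_le_mul_of_nonneg_left h2 (abs_nonneg _)
  linarith

/-- **Anchor energy along `t'` from a `K₂` CEILING word, target LEFT of the anchor** (`t' ≤ t'₀`, `K₂(σ) ≤ A`):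
`E^{src}_{t'₀}(σ) ≤ E^{src}_{t'}(σ) + (t'₀ − t')·A`. [cite: Israel1979, Thm. I.3.4] -/
theorem meanEnergy_sourced_anchor_le_of_diagHop_le (σ : InfVolFermionState 2) {t' t'₀ A : ℝ} (hle : t' ≤ t'₀)
    (hA : σ.meanEnergy (hubbardTTPrimeFermionInteraction 0 1 0) 1 ≤ A) (t U μ : ℝ) (g : Site 2 → ℝ) (h : ℝ) :
    σ.meanEnergy (hubbardTTPrimeSourcedInteraction t t'₀ U μ g h) 1 ≤
      σ.meanEnergy (hubbardTTPrimeSourcedInteraction t t' U μ g h) 1 + (t'₀ - t') * A := by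
  rw [σ.meanEnergy_sourced_tp_affine t t' t'₀ U μ g h]
  nlinarith [mul_le_mul_of_nonneg_left hA (sub_nonneg.2 hle)]

/-- **Anchor energy along `t'` from a `K₂` FLOOR word, target RIGHT of the anchor** (`t'₀ ≤ t'`, `B ≤ K₂(σ)`):
`E^{src}_{t'₀}(σ) ≤ E^{src}_{t'}(σ) − (t' − t'₀)·B`. [cite: Israel1979, Thm. I.3.4] -/
theorem meanEnergy_sourced_anchor_le_of_le_diagHop (σ : InfVolFermionState 2) {t' t'₀ B : ℝ} (hle : t'₀ ≤ t')
    (hB : B ≤ σ.meanEnergy (hubbardTTPrimeFermionInteraction 0 1 0) 1) (t U μ : ℝ) (g : Site 2 → ℝ) (h : ℝ) :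
    σ.meanEnergy (hubbardTTPrimeSourcedInteraction t t'₀ U μ g h) 1 ≤
      σ.meanEnergy (hubbardTTPrimeSourcedInteraction t t' U μ g h) 1 - (t' - t'₀) * B := by
  rw [σ.meanEnergy_sourced_tp_affine t t' t'₀ U μ g h]
  nlinarith [mul_le_mul_of_nonneg_left hB (sub_nonneg.2 hle)]

/-- **UPWARD in `U` is free**: for `U₀ ≤ U` and every state, `E^{src}_{t',U₀}(σ) ≤ E^{src}_{t',U}(σ)` (`D(σ) ≥ 0`).
[cite: Israel1979, Thm. I.3.4] -/
theorem meanEnergy_sourced_anchor_le_of_U_le (σ : InfVolFermionState 2) {U U₀ : ℝ} (hU : U₀ ≤ U) (t t' μ : ℝ)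
    (g : Site 2 → ℝ) (h : ℝ) :
    σ.meanEnergy (hubbardTTPrimeSourcedInteraction t t' U₀ μ g h) 1 ≤
      σ.meanEnergy (hubbardTTPrimeSourcedInteraction t t' U μ g h) 1 := by
  rw [σ.meanEnergy_sourced_affine t t' U t' U₀ μ g h, sub_self, zero_mul, add_zero]
  have hD := σ.meanEnergy_hubbardTTPrime_onSite_nonneg
  nlinarith [mul_nonneg (sub_nonneg.2 hU) hD]

/-- **Joint `(t', U)` anchor energy, kinematic**: for a translation-invariant `σ` of density `n`,
`E^{src}_{t'₀,U₀}(σ) ≤ E^{src}_{t',U}(σ) + (16/π²)|t'₀ − t'| + max(U₀ − U, 0)·(n/2)` (`0 ≤ D ≤ n/2`).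
[cite: Ruelle1969, §3.4] -/
theorem IsTranslationInvariant.meanEnergy_sourced_anchor₂_le_kinematic {σ : InfVolFermionState 2}
    (hσ : σ.IsTranslationInvariant) {n : ℝ} (hρ : σ.density = n) (t t' U t'₀ U₀ μ : ℝ) (g : Site 2 → ℝ) (h : ℝ) :
    σ.meanEnergy (hubbardTTPrimeSourcedInteraction t t'₀ U₀ μ g h) 1 ≤
      σ.meanEnergy (hubbardTTPrimeSourcedInteraction t t' U μ g h) 1 + 16 / Real.pi ^ 2 * |t'₀ - t'| +
        max (U₀ - U) 0 * (n / 2) := by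
  have h1 := hσ.meanEnergy_sourced_anchor_le_kinematic t t' t'₀ U μ g h
  -- move `U` at fixed `t'₀`
  have h2 : σ.meanEnergy (hubbardTTPrimeSourcedInteraction t t'₀ U₀ μ g h) 1 ≤
      σ.meanEnergy (hubbardTTPrimeSourcedInteraction t t'₀ U μ g h) 1 + max (U₀ - U) 0 * (n / 2) := by
    rw [σ.meanEnergy_sourced_affine t t'₀ U t'₀ U₀ μ g h, sub_self, zero_mul, add_zero]
    have hD0 := σ.meanEnergy_hubbardTTPrime_onSite_nonneg
    have hD1 : σ.meanEnergy (hubbardTTPrimeFermionInteraction 0 0 1) 1 ≤ n / 2 := by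
      rw [← hρ]; exact σ.meanEnergy_hubbardTTPrime_onSite_le_half_density
    have hm := le_max_left (U₀ - U) 0
    have hm0 := le_max_right (U₀ - U) 0
    nlinarith [mul_le_mul_of_nonneg_right hm hD0, mul_le_mul_of_nonneg_left hD1 hm0]
  linarith

end InfVolFermionState

/-! ### §3 The sourced minimum of the density-`n` class lies below the canonical source-free table -/

/-- **The energy-capped canonical class is inhabited from a canonical energy CEILING** (Literature form of
hubbard-obs-pin-1's `exists_ti_density_meanEnergy_sourced_le`): if `e(1,t',U;n) ≤ hi` (`U ≥ 0`, `0 ≤ n < 2`)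
then for EVERY field `h` some translation-invariant state `σ` of density `n` has sourced mean energy
`E^{src}_{t',U,h}(σ) ≤ hi` (chemical potential slot `0`) — a torus limit of sector ground states of the unsourced
model attains `e(1,t',U;n)`, is gauge invariant, hence has zero pair amplitude. [cite: BratteliRobinsonII1997, §5.2.2] -/
theorem exists_isTranslationInvariant_density_meanEnergy_sourced_le (t' : ℝ) {U : ℝ} (hU : 0 ≤ U) {n : ℝ}
    (hn0 : 0 ≤ n) (hn2 : n < 2) (h : ℝ) {hi : ℝ} (hhi : energyDensityTT' 1 t' U n ≤ hi) :
    ∃ σ : InfVolFermionState 2, σ.IsTranslationInvariant ∧ σ.density = n ∧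
      σ.meanEnergy (hubbardTTPrimeSourcedInteraction 1 t' U 0 dWaveFormFactor h) 1 ≤ hi := by
  -- adapted from Summits/Ventures/CertifiedManyBodySolver/Certificates/HubbardSquare_n7o8_pinning_menuA0p_responseCeilingM_nodes.lean
  obtain ⟨ψ, φ, ω, -, hψ, -, hω, hTI, -, hdens, hE⟩ :=
    exists_isTorusLimitOf_meanEnergy_hubbardTTPrime_eq 1 t' hU hn0 hn2 (Ls := id) tendsto_id
  have hG : ω.IsGaugeInvariant :=
    hω.isGaugeInvariant' (N := fun L => rectN n L) fun L => ((mem_szSector_iff _ _ _).1 (hψ L).1).1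
  refine ⟨ω, hTI, hdens, ?_⟩
  rw [InfVolFermionState.meanEnergy_hubbardTTPrimeSourced, InfVolFermionState.meanEnergy_pairSourceInteraction_dWave_eq,
    hG.expect_localPairAt_eq_zero, hE]
  simp only [Complex.zero_re, mul_zero, sub_zero, zero_mul]
  exact hhi

/-- **A density-`n` sourced minimiser lies below the canonical source-free cap**: if `ω` minimises the sourced
mean energy at `(t',U,h)` over the translation-invariant states of density `n` and `e(1,t',U;n) ≤ R`, then
`E^{src}_{t',U,h}(ω) ≤ R`. [cite: Ruelle1969, §3.4] -/
theorem meanEnergy_sourced_le_of_canonicalMinimiser {t' U n h R : ℝ} (hU : 0 ≤ U) (hn0 : 0 ≤ n) (hn2 : n < 2)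
    {ω : InfVolFermionState 2}
    (hmin : ∀ ω' : InfVolFermionState 2, ω'.IsTranslationInvariant → ω'.density = n →
      ω.meanEnergy (hubbardTTPrimeSourcedInteraction 1 t' U 0 dWaveFormFactor h) 1 ≤
        ω'.meanEnergy (hubbardTTPrimeSourcedInteraction 1 t' U 0 dWaveFormFactor h) 1)
    (hR : energyDensityTT' 1 t' U n ≤ R) :
    ω.meanEnergy (hubbardTTPrimeSourcedInteraction 1 t' U 0 dWaveFormFactor h) 1 ≤ R := by
  obtain ⟨σ, hσ, hσρ, hσE⟩ := exists_isTranslationInvariant_density_meanEnergy_sourced_le t' hU hn0 hn2 h hR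
  exact (hmin σ hσ hσρ).trans hσE

/-! ### §4 Cap-class transport for the canonical (density-`n`) class -/

section Canonical

variable {P : InfVolFermionState 2 → Prop}

/-- **CAP-CLASS TRANSPORT ALONG `t'`, kinematic**: a class sentence «every TI density-`n` `σ` with
`E^{src}_{t'₀,U,h}(σ) ≤ u` satisfies `P`» at the anchor `t'₀`, a canonical cap `e(1,t',U;n) ≤ R` at the target and
the slack condition `R + (16/π²)|t'₀ − t'| ≤ u` give `P ω` for every density-`n` sourced minimiser `ω` at `(t',U,h)`.
[cite: WangEtAl2024, §III] -/
theorem forall_canonicalMinimiser_of_capClass_tPrime {t'₀ t' U n h u R : ℝ} (hU : 0 ≤ U) (hn0 : 0 ≤ n) (hn2 : n < 2)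
    (hW : ∀ σ : InfVolFermionState 2, σ.IsTranslationInvariant → σ.density = n →
      σ.meanEnergy (hubbardTTPrimeSourcedInteraction 1 t'₀ U 0 dWaveFormFactor h) 1 ≤ u → P σ)
    (hR : energyDensityTT' 1 t' U n ≤ R) (hslack : R + 16 / Real.pi ^ 2 * |t'₀ - t'| ≤ u)
    {ω : InfVolFermionState 2} (hω : ω.IsTranslationInvariant) (hρ : ω.density = n)
    (hmin : ∀ ω' : InfVolFermionState 2, ω'.IsTranslationInvariant → ω'.density = n →
      ω.meanEnergy (hubbardTTPrimeSourcedInteraction 1 t' U 0 dWaveFormFactor h) 1 ≤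
        ω'.meanEnergy (hubbardTTPrimeSourcedInteraction 1 t' U 0 dWaveFormFactor h) 1) :
    P ω := by
  have h1 := meanEnergy_sourced_le_of_canonicalMinimiser hU hn0 hn2 hmin hR
  have h2 := hω.meanEnergy_sourced_anchor_le_kinematic 1 t' t'₀ U 0 dWaveFormFactor h
  exact hW ω hω hρ (by linarith)

/-- **CAP-CLASS TRANSPORT ON A `t'`-INTERVAL, kinematic**: with a canonical cap `e(1,t',U;n) ≤ R` on `[s₁,s₂]` and
`R + (16/π²)·max(t'₀ − s₁, s₂ − t'₀) ≤ u`, the class sentence holds for every density-`n` sourced minimiser at every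
`t' ∈ [s₁,s₂]`. [cite: WangEtAl2024, §III] -/
theorem forall_canonicalMinimiser_of_capClass_tPrime_interval {t'₀ s₁ s₂ U n h u R : ℝ} (hU : 0 ≤ U) (hn0 : 0 ≤ n)
    (hn2 : n < 2)
    (hW : ∀ σ : InfVolFermionState 2, σ.IsTranslationInvariant → σ.density = n →
      σ.meanEnergy (hubbardTTPrimeSourcedInteraction 1 t'₀ U 0 dWaveFormFactor h) 1 ≤ u → P σ)
    (hR : ∀ s ∈ Set.Icc s₁ s₂, energyDensityTT' 1 s U n ≤ R)
    (hslack : R + 16 / Real.pi ^ 2 * max (t'₀ - s₁) (s₂ - t'₀) ≤ u)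
    {t' : ℝ} (h₁ : s₁ ≤ t') (h₂ : t' ≤ s₂)
    {ω : InfVolFermionState 2} (hω : ω.IsTranslationInvariant) (hρ : ω.density = n)
    (hmin : ∀ ω' : InfVolFermionState 2, ω'.IsTranslationInvariant → ω'.density = n →
      ω.meanEnergy (hubbardTTPrimeSourcedInteraction 1 t' U 0 dWaveFormFactor h) 1 ≤
        ω'.meanEnergy (hubbardTTPrimeSourcedInteraction 1 t' U 0 dWaveFormFactor h) 1) :
    P ω := by
  have habs : |t'₀ - t'| ≤ max (t'₀ - s₁) (s₂ - t'₀) := by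
    rw [abs_le]
    constructor
    · have := le_max_right (t'₀ - s₁) (s₂ - t'₀); linarith
    · have := le_max_left (t'₀ - s₁) (s₂ - t'₀); linarith
  have hκ : (0 : ℝ) ≤ 16 / Real.pi ^ 2 := by positivity
  refine forall_canonicalMinimiser_of_capClass_tPrime hU hn0 hn2 hW (hR t' ⟨h₁, h₂⟩) ?_ hω hρ hmin
  nlinarith [mul_le_mul_of_nonneg_left habs hκ]

/-- **CAP-CLASS TRANSPORT TO A `(t', U)` TARGET ABOVE THE ANCHOR'S `U`**, kinematic in `t'`, free in `U`
(`U₀ ≤ U`): class sentence at `(t'₀, U₀)`, canonical cap `e(1,t',U;n) ≤ R` at the target (`U ≥ 0`) and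
`R + (16/π²)|t'₀ − t'| ≤ u` give `P` for every density-`n` sourced minimiser at `(t', U, h)`. [cite: WangEtAl2024, §III] -/
theorem forall_canonicalMinimiser_of_capClass_tPrime_U {t'₀ t' U₀ U n h u R : ℝ} (hU : 0 ≤ U) (hU₀ : U₀ ≤ U)
    (hn0 : 0 ≤ n) (hn2 : n < 2)
    (hW : ∀ σ : InfVolFermionState 2, σ.IsTranslationInvariant → σ.density = n →
      σ.meanEnergy (hubbardTTPrimeSourcedInteraction 1 t'₀ U₀ 0 dWaveFormFactor h) 1 ≤ u → P σ)
    (hR : energyDensityTT' 1 t' U n ≤ R) (hslack : R + 16 / Real.pi ^ 2 * |t'₀ - t'| ≤ u)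
    {ω : InfVolFermionState 2} (hω : ω.IsTranslationInvariant) (hρ : ω.density = n)
    (hmin : ∀ ω' : InfVolFermionState 2, ω'.IsTranslationInvariant → ω'.density = n →
      ω.meanEnergy (hubbardTTPrimeSourcedInteraction 1 t' U 0 dWaveFormFactor h) 1 ≤
        ω'.meanEnergy (hubbardTTPrimeSourcedInteraction 1 t' U 0 dWaveFormFactor h) 1) :
    P ω := by
  have h1 := meanEnergy_sourced_le_of_canonicalMinimiser hU hn0 hn2 hmin hR
  have h2 := hω.meanEnergy_sourced_anchor_le_kinematic 1 t' t'₀ U 0 dWaveFormFactor h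
  have h3 := ω.meanEnergy_sourced_anchor_le_of_U_le hU₀ 1 t'₀ 0 dWaveFormFactor h
  exact hW ω hω hρ (by linarith)

/-- **CAP-CLASS TRANSPORT TO ANY `(t', U)` TARGET, kinematic in both** (`U` below the anchor pays
`(U₀ − U)·n/2`): `R + (16/π²)|t'₀ − t'| + max(U₀ − U, 0)·n/2 ≤ u` suffices. [cite: WangEtAl2024, §III] -/
theorem forall_canonicalMinimiser_of_capClass_tPrime_U_kinematic {t'₀ t' U₀ U n h u R : ℝ} (hU : 0 ≤ U)
    (hn0 : 0 ≤ n) (hn2 : n < 2)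
    (hW : ∀ σ : InfVolFermionState 2, σ.IsTranslationInvariant → σ.density = n →
      σ.meanEnergy (hubbardTTPrimeSourcedInteraction 1 t'₀ U₀ 0 dWaveFormFactor h) 1 ≤ u → P σ)
    (hR : energyDensityTT' 1 t' U n ≤ R)
    (hslack : R + 16 / Real.pi ^ 2 * |t'₀ - t'| + max (U₀ - U) 0 * (n / 2) ≤ u)
    {ω : InfVolFermionState 2} (hω : ω.IsTranslationInvariant) (hρ : ω.density = n)
    (hmin : ∀ ω' : InfVolFermionState 2, ω'.IsTranslationInvariant → ω'.density = n →
      ω.meanEnergy (hubbardTTPrimeSourcedInteraction 1 t' U 0 dWaveFormFactor h) 1 ≤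
        ω'.meanEnergy (hubbardTTPrimeSourcedInteraction 1 t' U 0 dWaveFormFactor h) 1) :
    P ω := by
  have h1 := meanEnergy_sourced_le_of_canonicalMinimiser hU hn0 hn2 hmin hR
  have h2 := hω.meanEnergy_sourced_anchor₂_le_kinematic hρ 1 t' U t'₀ U₀ 0 dWaveFormFactor h
  exact hW ω hω hρ (by linarith)

/-- **CAP-CLASS TRANSPORT ALONG `t'` WITH `K₂` WORDS ON THE TARGET STATE** (target left of the anchor,
`K₂(ω) ≤ A`): `R + (t'₀ − t')·A ≤ u` suffices. [cite: WangEtAl2024, §III] -/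
theorem forall_canonicalMinimiser_of_capClass_tPrime_of_diagHop_le {t'₀ t' U n h u R A : ℝ} (hU : 0 ≤ U)
    (hn0 : 0 ≤ n) (hn2 : n < 2) (hle : t' ≤ t'₀)
    (hW : ∀ σ : InfVolFermionState 2, σ.IsTranslationInvariant → σ.density = n →
      σ.meanEnergy (hubbardTTPrimeSourcedInteraction 1 t'₀ U 0 dWaveFormFactor h) 1 ≤ u → P σ)
    (hR : energyDensityTT' 1 t' U n ≤ R) (hslack : R + (t'₀ - t') * A ≤ u)
    {ω : InfVolFermionState 2} (hω : ω.IsTranslationInvariant) (hρ : ω.density = n)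
    (hA : ω.meanEnergy (hubbardTTPrimeFermionInteraction 0 1 0) 1 ≤ A)
    (hmin : ∀ ω' : InfVolFermionState 2, ω'.IsTranslationInvariant → ω'.density = n →
      ω.meanEnergy (hubbardTTPrimeSourcedInteraction 1 t' U 0 dWaveFormFactor h) 1 ≤
        ω'.meanEnergy (hubbardTTPrimeSourcedInteraction 1 t' U 0 dWaveFormFactor h) 1) :
    P ω := by
  have h1 := meanEnergy_sourced_le_of_canonicalMinimiser hU hn0 hn2 hmin hR
  have h2 := ω.meanEnergy_sourced_anchor_le_of_diagHop_le hle hA 1 U 0 dWaveFormFactor h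
  exact hW ω hω hρ (by linarith)

/-- The same with the target RIGHT of the anchor and a `K₂` FLOOR word `B ≤ K₂(ω)`: `R − (t' − t'₀)·B ≤ u` suffices.
[cite: WangEtAl2024, §III] -/
theorem forall_canonicalMinimiser_of_capClass_tPrime_of_le_diagHop {t'₀ t' U n h u R B : ℝ} (hU : 0 ≤ U)
    (hn0 : 0 ≤ n) (hn2 : n < 2) (hle : t'₀ ≤ t')
    (hW : ∀ σ : InfVolFermionState 2, σ.IsTranslationInvariant → σ.density = n →
      σ.meanEnergy (hubbardTTPrimeSourcedInteraction 1 t'₀ U 0 dWaveFormFactor h) 1 ≤ u → P σ)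
    (hR : energyDensityTT' 1 t' U n ≤ R) (hslack : R - (t' - t'₀) * B ≤ u)
    {ω : InfVolFermionState 2} (hω : ω.IsTranslationInvariant) (hρ : ω.density = n)
    (hB : B ≤ ω.meanEnergy (hubbardTTPrimeFermionInteraction 0 1 0) 1)
    (hmin : ∀ ω' : InfVolFermionState 2, ω'.IsTranslationInvariant → ω'.density = n →
      ω.meanEnergy (hubbardTTPrimeSourcedInteraction 1 t' U 0 dWaveFormFactor h) 1 ≤
        ω'.meanEnergy (hubbardTTPrimeSourcedInteraction 1 t' U 0 dWaveFormFactor h) 1) :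
    P ω := by
  have h1 := meanEnergy_sourced_le_of_canonicalMinimiser hU hn0 hn2 hmin hR
  have h2 := ω.meanEnergy_sourced_anchor_le_of_le_diagHop hle hB 1 U 0 dWaveFormFactor h
  exact hW ω hω hρ (by linarith)

/-- **PRICED CAP-CLASS TRANSPORT ALONG `t'`** (the Lagrangian reading of a dual certificate: for ALL TI density-`n`
`σ`, `f σ ≤ M + κ·(E^{src}_{t'₀}(σ) − u₀)`, `κ ≥ 0` the cap row's multiplier): every density-`n` sourced minimiser
`ω` at `t'` has `f ω ≤ M + κ·(R + (16/π²)|t'₀ − t'| − u₀)` — no feasibility condition; a GAIN when the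
transported cap is below `u₀`. [cite: WangEtAl2024, §III] -/
theorem canonicalMinimiser_le_priced_of_capClass_tPrime {f : InfVolFermionState 2 → ℝ} {t'₀ t' U n h u₀ R M κ : ℝ}
    (hU : 0 ≤ U) (hn0 : 0 ≤ n) (hn2 : n < 2) (hκ : 0 ≤ κ)
    (hW : ∀ σ : InfVolFermionState 2, σ.IsTranslationInvariant → σ.density = n →
      f σ ≤ M + κ * (σ.meanEnergy (hubbardTTPrimeSourcedInteraction 1 t'₀ U 0 dWaveFormFactor h) 1 - u₀))
    (hR : energyDensityTT' 1 t' U n ≤ R)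
    {ω : InfVolFermionState 2} (hω : ω.IsTranslationInvariant) (hρ : ω.density = n)
    (hmin : ∀ ω' : InfVolFermionState 2, ω'.IsTranslationInvariant → ω'.density = n →
      ω.meanEnergy (hubbardTTPrimeSourcedInteraction 1 t' U 0 dWaveFormFactor h) 1 ≤
        ω'.meanEnergy (hubbardTTPrimeSourcedInteraction 1 t' U 0 dWaveFormFactor h) 1) :
    f ω ≤ M + κ * (R + 16 / Real.pi ^ 2 * |t'₀ - t'| - u₀) := by
  have h1 := meanEnergy_sourced_le_of_canonicalMinimiser hU hn0 hn2 hmin hR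
  have h2 := hω.meanEnergy_sourced_anchor_le_kinematic 1 t' t'₀ U 0 dWaveFormFactor h
  refine (hW ω hω hρ).trans ?_
  nlinarith [mul_le_mul_of_nonneg_left (show ω.meanEnergy (hubbardTTPrimeSourcedInteraction 1 t'₀ U 0 dWaveFormFactor h) 1 - u₀ ≤
    R + 16 / Real.pi ^ 2 * |t'₀ - t'| - u₀ by linarith) hκ]

/-- **PRICED CAP-CLASS TRANSPORT TO A `(t', U)` TARGET**, kinematic in both couplings:
`f ω ≤ M + κ·(R + (16/π²)|t'₀ − t'| + max(U₀ − U, 0)·n/2 − u₀)`. [cite: WangEtAl2024, §III] -/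
theorem canonicalMinimiser_le_priced_of_capClass_tPrime_U {f : InfVolFermionState 2 → ℝ}
    {t'₀ t' U₀ U n h u₀ R M κ : ℝ} (hU : 0 ≤ U) (hn0 : 0 ≤ n) (hn2 : n < 2) (hκ : 0 ≤ κ)
    (hW : ∀ σ : InfVolFermionState 2, σ.IsTranslationInvariant → σ.density = n →
      f σ ≤ M + κ * (σ.meanEnergy (hubbardTTPrimeSourcedInteraction 1 t'₀ U₀ 0 dWaveFormFactor h) 1 - u₀))
    (hR : energyDensityTT' 1 t' U n ≤ R)
    {ω : InfVolFermionState 2} (hω : ω.IsTranslationInvariant) (hρ : ω.density = n)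
    (hmin : ∀ ω' : InfVolFermionState 2, ω'.IsTranslationInvariant → ω'.density = n →
      ω.meanEnergy (hubbardTTPrimeSourcedInteraction 1 t' U 0 dWaveFormFactor h) 1 ≤
        ω'.meanEnergy (hubbardTTPrimeSourcedInteraction 1 t' U 0 dWaveFormFactor h) 1) :
    f ω ≤ M + κ * (R + 16 / Real.pi ^ 2 * |t'₀ - t'| + max (U₀ - U) 0 * (n / 2) - u₀) := by
  have h1 := meanEnergy_sourced_le_of_canonicalMinimiser hU hn0 hn2 hmin hR
  have h2 := hω.meanEnergy_sourced_anchor₂_le_kinematic hρ 1 t' U t'₀ U₀ 0 dWaveFormFactor h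
  refine (hW ω hω hρ).trans ?_
  nlinarith [mul_le_mul_of_nonneg_left (show ω.meanEnergy (hubbardTTPrimeSourcedInteraction 1 t'₀ U₀ 0 dWaveFormFactor h) 1 - u₀ ≤
    R + 16 / Real.pi ^ 2 * |t'₀ - t'| + max (U₀ - U) 0 * (n / 2) - u₀ by linarith) hκ]

end Canonical

/-! ### §5 Cap-class transport for the grand-canonical class (Bratteli–Kishimoto–Robinson minimisers) -/

section GrandCanonical

variable {P : InfVolFermionState 2 → Prop}

/-- A grand-canonical sourced minimiser carries the sourced energy density: `E^{src}_{t',U,μ,h}(ω) = E(t',U,μ,h)`.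
[cite: Israel1979, Thm. I.3.4] -/
theorem InfVolFermionState.IsMeanEnergyMinimiser.meanEnergy_sourced_eq {t' U μ h : ℝ} {ω : InfVolFermionState 2}
    (hω : ω.IsMeanEnergyMinimiser (hubbardTTPrimeSourcedInteraction 1 t' U μ dWaveFormFactor h) 1) :
    ω.meanEnergy (hubbardTTPrimeSourcedInteraction 1 t' U μ dWaveFormFactor h) 1 = dWaveSourceEnergyDensityTT' t' U μ h := by
  rw [hω.meanEnergy_eq, dWaveSourceEnergyDensityTT'_eq_tiGroundEnergyDensity]

/-- **GC CAP-CLASS TRANSPORT ALONG `t'`, kinematic**: a class sentence «every TI `σ` with `E^{src}_{t'₀,U,μ,h}(σ) ≤ u`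
satisfies `P`», a cap `E(t',U,μ,h) ≤ hi` on the sourced grand-canonical density at the target and
`hi + (16/π²)|t'₀ − t'| ≤ u` give `P ω` for every grand-canonical sourced minimiser `ω` at `(t',U,μ,h)`.
[cite: WangEtAl2024, §III] -/
theorem forall_gcMinimiser_of_capClass_tPrime {t'₀ t' U μ h u hi : ℝ}
    (hW : ∀ σ : InfVolFermionState 2, σ.IsTranslationInvariant →
      σ.meanEnergy (hubbardTTPrimeSourcedInteraction 1 t'₀ U μ dWaveFormFactor h) 1 ≤ u → P σ)
    (hhi : dWaveSourceEnergyDensityTT' t' U μ h ≤ hi) (hslack : hi + 16 / Real.pi ^ 2 * |t'₀ - t'| ≤ u)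
    {ω : InfVolFermionState 2}
    (hω : ω.IsMeanEnergyMinimiser (hubbardTTPrimeSourcedInteraction 1 t' U μ dWaveFormFactor h) 1) : P ω := by
  have h1 := hω.meanEnergy_sourced_eq
  have h2 := hω.1.meanEnergy_sourced_anchor_le_kinematic 1 t' t'₀ U μ dWaveFormFactor h
  exact hW ω hω.1 (by linarith)

/-- **GC CAP-CLASS TRANSPORT from a CANONICAL cap** (`E(t',U,μ,h) ≤ e(1,t',U;n) − μn`, Legendre): `U ≥ 0`,
`0 ≤ n < 2`, `e(1,t',U;n) ≤ R` and `R − μn + (16/π²)|t'₀ − t'| ≤ u` suffice. [cite: Ruelle1969, §3.4] -/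
theorem forall_gcMinimiser_of_capClass_tPrime_of_canonicalCap {t'₀ t' U μ h u n R : ℝ} (hU : 0 ≤ U)
    (hn0 : 0 ≤ n) (hn2 : n < 2)
    (hW : ∀ σ : InfVolFermionState 2, σ.IsTranslationInvariant →
      σ.meanEnergy (hubbardTTPrimeSourcedInteraction 1 t'₀ U μ dWaveFormFactor h) 1 ≤ u → P σ)
    (hR : energyDensityTT' 1 t' U n ≤ R) (hslack : R - μ * n + 16 / Real.pi ^ 2 * |t'₀ - t'| ≤ u)
    {ω : InfVolFermionState 2}
    (hω : ω.IsMeanEnergyMinimiser (hubbardTTPrimeSourcedInteraction 1 t' U μ dWaveFormFactor h) 1) : P ω :=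
  forall_gcMinimiser_of_capClass_tPrime hW (dWaveSourceEnergyDensityTT'_le_of_energyDensityTT'_le t' hU μ h hn0 hn2 hR)
    hslack hω

/-- **GC CAP-CLASS TRANSPORT ON A `(t', U, μ)` CELL** (`U₀ ≤ U`, free in `U`; any `μ` with a cap at the target):
class sentence at `(t'₀, U₀, μ)`, cap `E(t',U,μ,h) ≤ hi`, `hi + (16/π²)|t'₀ − t'| ≤ u`. [cite: WangEtAl2024, §III] -/
theorem forall_gcMinimiser_of_capClass_tPrime_U {t'₀ t' U₀ U μ h u hi : ℝ} (hU₀ : U₀ ≤ U)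
    (hW : ∀ σ : InfVolFermionState 2, σ.IsTranslationInvariant →
      σ.meanEnergy (hubbardTTPrimeSourcedInteraction 1 t'₀ U₀ μ dWaveFormFactor h) 1 ≤ u → P σ)
    (hhi : dWaveSourceEnergyDensityTT' t' U μ h ≤ hi) (hslack : hi + 16 / Real.pi ^ 2 * |t'₀ - t'| ≤ u)
    {ω : InfVolFermionState 2}
    (hω : ω.IsMeanEnergyMinimiser (hubbardTTPrimeSourcedInteraction 1 t' U μ dWaveFormFactor h) 1) : P ω := by
  have h1 := hω.meanEnergy_sourced_eq
  have h2 := hω.1.meanEnergy_sourced_anchor_le_kinematic 1 t' t'₀ U μ dWaveFormFactor h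
  have h3 := ω.meanEnergy_sourced_anchor_le_of_U_le hU₀ 1 t'₀ μ dWaveFormFactor h
  exact hW ω hω.1 (by linarith)

/-- **PRICED GC CAP-CLASS TRANSPORT ALONG `t'`**: «`f σ ≤ M + κ·(E^{src}_{t'₀,U,μ,h}(σ) − u₀)` for all TI `σ`»,
`κ ≥ 0`, and a cap `E(t',U,μ,h) ≤ hi` give `f ω ≤ M + κ·(hi + (16/π²)|t'₀ − t'| − u₀)` for every grand-canonical
sourced minimiser at `(t',U,μ,h)`. [cite: WangEtAl2024, §III] -/
theorem gcMinimiser_le_priced_of_capClass_tPrime {f : InfVolFermionState 2 → ℝ} {t'₀ t' U μ h u₀ hi M κ : ℝ}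
    (hκ : 0 ≤ κ)
    (hW : ∀ σ : InfVolFermionState 2, σ.IsTranslationInvariant →
      f σ ≤ M + κ * (σ.meanEnergy (hubbardTTPrimeSourcedInteraction 1 t'₀ U μ dWaveFormFactor h) 1 - u₀))
    (hhi : dWaveSourceEnergyDensityTT' t' U μ h ≤ hi) {ω : InfVolFermionState 2}
    (hω : ω.IsMeanEnergyMinimiser (hubbardTTPrimeSourcedInteraction 1 t' U μ dWaveFormFactor h) 1) :
    f ω ≤ M + κ * (hi + 16 / Real.pi ^ 2 * |t'₀ - t'| - u₀) := by
  have h1 := hω.meanEnergy_sourced_eq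
  have h2 := hω.1.meanEnergy_sourced_anchor_le_kinematic 1 t' t'₀ U μ dWaveFormFactor h
  refine (hW ω hω.1).trans ?_
  nlinarith [mul_le_mul_of_nonneg_left (show ω.meanEnergy (hubbardTTPrimeSourcedInteraction 1 t'₀ U μ dWaveFormFactor h) 1 - u₀ ≤
    hi + 16 / Real.pi ^ 2 * |t'₀ - t'| - u₀ by linarith) hκ]

end GrandCanonical

/-! ### §6 The pair-amplitude slot of the pinning menus (`√2·Re σ(P₀^d) ≤ M̃`) -/

section PairAmplitude

/-- **A `t'`-BOX OF RESPONSE / ORDER CEILINGS FROM ONE MENU NODE** (the `hM` node shape of the pinning menus,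
verbatim, at the anchor `(t'₀, U₀)`; target `(t', U)` with `U₀ ≤ U`, `U ≥ 0`): if
`e(1,t',U;n) ≤ R` and `R + (16/π²)|t'₀ − t'| ≤ u`, then every translation-invariant density-`n` minimiser of
the sourced energy at `(t', U, h)` has `√2·Re ω(P₀^d) ≤ M̃`. At `h = 0` this caps the `d`-wave pair amplitude of
every translation-invariant density-`n` ground state of the UNSOURCED `t–t'` model at `(t', U)`. Ceiling only.
[cite: WangEtAl2024, §III] -/
theorem canonicalMinimiser_sqrtTwo_mul_pairAmp_le_of_menuNode_tPrime_U {t'₀ t' U₀ U n h u R Mt : ℝ} (hU : 0 ≤ U)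
    (hU₀ : U₀ ≤ U) (hn0 : 0 ≤ n) (hn2 : n < 2)
    (hM : ∀ σ : InfVolFermionState 2, σ.IsTranslationInvariant → σ.density = n →
      σ.meanEnergy (hubbardTTPrimeSourcedInteraction 1 t'₀ U₀ 0 dWaveFormFactor h) 1 ≤ u →
        Real.sqrt 2 * (σ.expect (pairRegion (insert 0 unitSteps) 0)
          (localPairAt (insert 0 unitSteps) dWaveFormFactor 0)).re ≤ Mt)
    (hR : energyDensityTT' 1 t' U n ≤ R) (hslack : R + 16 / Real.pi ^ 2 * |t'₀ - t'| ≤ u)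
    {ω : InfVolFermionState 2} (hω : ω.IsTranslationInvariant) (hρ : ω.density = n)
    (hmin : ∀ ω' : InfVolFermionState 2, ω'.IsTranslationInvariant → ω'.density = n →
      ω.meanEnergy (hubbardTTPrimeSourcedInteraction 1 t' U 0 dWaveFormFactor h) 1 ≤
        ω'.meanEnergy (hubbardTTPrimeSourcedInteraction 1 t' U 0 dWaveFormFactor h) 1) :
    Real.sqrt 2 * (ω.expect (pairRegion (insert 0 unitSteps) 0)
      (localPairAt (insert 0 unitSteps) dWaveFormFactor 0)).re ≤ Mt :=
  forall_canonicalMinimiser_of_capClass_tPrime_U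
    (P := fun σ => Real.sqrt 2 * (σ.expect (pairRegion (insert 0 unitSteps) 0)
      (localPairAt (insert 0 unitSteps) dWaveFormFactor 0)).re ≤ Mt)
    hU hU₀ hn0 hn2 hM hR hslack hω hρ hmin

/-- **The `t'`-INTERVAL form at the anchor's `U`**: canonical cap `R` on `[s₁,s₂]`,
`R + (16/π²)·max(t'₀ − s₁, s₂ − t'₀) ≤ u` ⇒ `√2·Re ω(P₀^d) ≤ M̃` for every density-`n` sourced minimiser at every
`t' ∈ [s₁,s₂]`. [cite: WangEtAl2024, §III] -/
theorem canonicalMinimiser_sqrtTwo_mul_pairAmp_le_of_menuNode_tPrime_interval {t'₀ s₁ s₂ U n h u R Mt : ℝ}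
    (hU : 0 ≤ U) (hn0 : 0 ≤ n) (hn2 : n < 2)
    (hM : ∀ σ : InfVolFermionState 2, σ.IsTranslationInvariant → σ.density = n →
      σ.meanEnergy (hubbardTTPrimeSourcedInteraction 1 t'₀ U 0 dWaveFormFactor h) 1 ≤ u →
        Real.sqrt 2 * (σ.expect (pairRegion (insert 0 unitSteps) 0)
          (localPairAt (insert 0 unitSteps) dWaveFormFactor 0)).re ≤ Mt)
    (hR : ∀ s ∈ Set.Icc s₁ s₂, energyDensityTT' 1 s U n ≤ R)
    (hslack : R + 16 / Real.pi ^ 2 * max (t'₀ - s₁) (s₂ - t'₀) ≤ u)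
    {t' : ℝ} (h₁ : s₁ ≤ t') (h₂ : t' ≤ s₂)
    {ω : InfVolFermionState 2} (hω : ω.IsTranslationInvariant) (hρ : ω.density = n)
    (hmin : ∀ ω' : InfVolFermionState 2, ω'.IsTranslationInvariant → ω'.density = n →
      ω.meanEnergy (hubbardTTPrimeSourcedInteraction 1 t' U 0 dWaveFormFactor h) 1 ≤
        ω'.meanEnergy (hubbardTTPrimeSourcedInteraction 1 t' U 0 dWaveFormFactor h) 1) :
    Real.sqrt 2 * (ω.expect (pairRegion (insert 0 unitSteps) 0)
      (localPairAt (insert 0 unitSteps) dWaveFormFactor 0)).re ≤ Mt :=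
  forall_canonicalMinimiser_of_capClass_tPrime_interval
    (P := fun σ => Real.sqrt 2 * (σ.expect (pairRegion (insert 0 unitSteps) 0)
      (localPairAt (insert 0 unitSteps) dWaveFormFactor 0)).re ≤ Mt)
    hU hn0 hn2 hM hR hslack h₁ h₂ hω hρ hmin

/-- **PRICED `t'`-BOX OF RESPONSE CEILINGS** (priced node shape «`√2·Re σ(P₀^d) ≤ M̃ + κ·(E^{src}_{t'₀,U₀,h}(σ) − u₀)`
for all TI density-`n` `σ`»): every density-`n` sourced minimiser at `(t', U, h)` (`U ≥ 0`) has
`√2·Re ω(P₀^d) ≤ M̃ + κ·(R + (16/π²)|t'₀ − t'| + max(U₀ − U, 0)·n/2 − u₀)`. [cite: WangEtAl2024, §III] -/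
theorem canonicalMinimiser_sqrtTwo_mul_pairAmp_le_priced_of_menuNode_tPrime_U
    {t'₀ t' U₀ U n h u₀ R Mt κ : ℝ} (hU : 0 ≤ U) (hn0 : 0 ≤ n) (hn2 : n < 2) (hκ : 0 ≤ κ)
    (hM : ∀ σ : InfVolFermionState 2, σ.IsTranslationInvariant → σ.density = n →
      Real.sqrt 2 * (σ.expect (pairRegion (insert 0 unitSteps) 0)
          (localPairAt (insert 0 unitSteps) dWaveFormFactor 0)).re ≤
        Mt + κ * (σ.meanEnergy (hubbardTTPrimeSourcedInteraction 1 t'₀ U₀ 0 dWaveFormFactor h) 1 - u₀))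
    (hR : energyDensityTT' 1 t' U n ≤ R)
    {ω : InfVolFermionState 2} (hω : ω.IsTranslationInvariant) (hρ : ω.density = n)
    (hmin : ∀ ω' : InfVolFermionState 2, ω'.IsTranslationInvariant → ω'.density = n →
      ω.meanEnergy (hubbardTTPrimeSourcedInteraction 1 t' U 0 dWaveFormFactor h) 1 ≤
        ω'.meanEnergy (hubbardTTPrimeSourcedInteraction 1 t' U 0 dWaveFormFactor h) 1) :
    Real.sqrt 2 * (ω.expect (pairRegion (insert 0 unitSteps) 0)
      (localPairAt (insert 0 unitSteps) dWaveFormFactor 0)).re ≤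
      Mt + κ * (R + 16 / Real.pi ^ 2 * |t'₀ - t'| + max (U₀ - U) 0 * (n / 2) - u₀) :=
  canonicalMinimiser_le_priced_of_capClass_tPrime_U
    (f := fun σ => Real.sqrt 2 * (σ.expect (pairRegion (insert 0 unitSteps) 0)
      (localPairAt (insert 0 unitSteps) dWaveFormFactor 0)).re)
    hU hn0 hn2 hκ hM hR hω hρ hmin

end PairAmplitude

/-! ### §7 Filling-INTERVAL classes: the `(t', U, n)` material cell from ONE interval-filling menu -/

section FillingInterval

variable {P : InfVolFermionState 2 → Prop}

/-- **CAP-CLASS TRANSPORT FOR AN INTERVAL-FILLING NODE** «every TI `σ` with `σ.density ∈ [n₁,n₂]` and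
`E^{src}_{t'₀,U₀,h}(σ) ≤ u` satisfies `P`»: for every filling `n ∈ [n₁,n₂]` (`0 ≤ n₁`, `n₂ < 2`), every
density-`n` sourced minimiser `ω` at a target `(t', U)` with `U₀ ≤ U`, `U ≥ 0`, a canonical cap
`e(1,t',U;n) ≤ R` and `R + (16/π²)|t'₀ − t'| ≤ u` satisfies `P` — the `(t', U, n)` cell of the material phase
map from ONE menu. [cite: WangEtAl2024, §III] -/
theorem forall_canonicalMinimiser_of_capClass_fillingInterval_tPrime_U {t'₀ t' U₀ U n₁ n₂ n h u R : ℝ}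
    (hU : 0 ≤ U) (hU₀ : U₀ ≤ U) (hn₁ : 0 ≤ n₁) (hn₂ : n₂ < 2) (hn : n ∈ Set.Icc n₁ n₂)
    (hW : ∀ σ : InfVolFermionState 2, σ.IsTranslationInvariant → σ.density ∈ Set.Icc n₁ n₂ →
      σ.meanEnergy (hubbardTTPrimeSourcedInteraction 1 t'₀ U₀ 0 dWaveFormFactor h) 1 ≤ u → P σ)
    (hR : energyDensityTT' 1 t' U n ≤ R) (hslack : R + 16 / Real.pi ^ 2 * |t'₀ - t'| ≤ u)
    {ω : InfVolFermionState 2} (hω : ω.IsTranslationInvariant) (hρ : ω.density = n)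
    (hmin : ∀ ω' : InfVolFermionState 2, ω'.IsTranslationInvariant → ω'.density = n →
      ω.meanEnergy (hubbardTTPrimeSourcedInteraction 1 t' U 0 dWaveFormFactor h) 1 ≤
        ω'.meanEnergy (hubbardTTPrimeSourcedInteraction 1 t' U 0 dWaveFormFactor h) 1) :
    P ω := by
  have hn0 : 0 ≤ n := hn₁.trans hn.1
  have hn2 : n < 2 := lt_of_le_of_lt hn.2 hn₂
  have h1 := meanEnergy_sourced_le_of_canonicalMinimiser hU hn0 hn2 hmin hR
  have h2 := hω.meanEnergy_sourced_anchor_le_kinematic 1 t' t'₀ U 0 dWaveFormFactor h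
  have h3 := ω.meanEnergy_sourced_anchor_le_of_U_le hU₀ 1 t'₀ 0 dWaveFormFactor h
  exact hW ω hω (hρ ▸ hn) (by linarith)

/-- **THE `(t', U, n)` CELL FROM ONE INTERVAL-FILLING MENU**: a canonical cap `e(1,s,V;m) ≤ R` uniform on the cell
`[s₁,s₂] × [U₀,U₂] × [n₁,n₂]` (`U₀ ≥ 0`, `0 ≤ n₁`, `n₂ < 2`) and `R + (16/π²)·max(t'₀ − s₁, s₂ − t'₀) ≤ u` give `P`
for every density-`n` sourced minimiser at every `(t', U, n)` of the cell. [cite: WangEtAl2024, §III] -/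
theorem forall_canonicalMinimiser_of_capClass_fillingInterval_cell {t'₀ s₁ s₂ U₀ U₂ n₁ n₂ h u R : ℝ}
    (hU₀ : 0 ≤ U₀) (hn₁ : 0 ≤ n₁) (hn₂ : n₂ < 2)
    (hW : ∀ σ : InfVolFermionState 2, σ.IsTranslationInvariant → σ.density ∈ Set.Icc n₁ n₂ →
      σ.meanEnergy (hubbardTTPrimeSourcedInteraction 1 t'₀ U₀ 0 dWaveFormFactor h) 1 ≤ u → P σ)
    (hR : ∀ s ∈ Set.Icc s₁ s₂, ∀ V ∈ Set.Icc U₀ U₂, ∀ m ∈ Set.Icc n₁ n₂, energyDensityTT' 1 s V m ≤ R)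
    (hslack : R + 16 / Real.pi ^ 2 * max (t'₀ - s₁) (s₂ - t'₀) ≤ u)
    {t' U n : ℝ} (ht : t' ∈ Set.Icc s₁ s₂) (hUm : U ∈ Set.Icc U₀ U₂) (hn : n ∈ Set.Icc n₁ n₂)
    {ω : InfVolFermionState 2} (hω : ω.IsTranslationInvariant) (hρ : ω.density = n)
    (hmin : ∀ ω' : InfVolFermionState 2, ω'.IsTranslationInvariant → ω'.density = n →
      ω.meanEnergy (hubbardTTPrimeSourcedInteraction 1 t' U 0 dWaveFormFactor h) 1 ≤
        ω'.meanEnergy (hubbardTTPrimeSourcedInteraction 1 t' U 0 dWaveFormFactor h) 1) :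
    P ω := by
  have habs : |t'₀ - t'| ≤ max (t'₀ - s₁) (s₂ - t'₀) := by
    rw [abs_le]
    constructor
    · have := le_max_right (t'₀ - s₁) (s₂ - t'₀); linarith [ht.2]
    · have := le_max_left (t'₀ - s₁) (s₂ - t'₀); linarith [ht.1]
  have hκ : (0 : ℝ) ≤ 16 / Real.pi ^ 2 := by positivity
  refine forall_canonicalMinimiser_of_capClass_fillingInterval_tPrime_U (hU₀.trans hUm.1) hUm.1 hn₁ hn₂ hn hW
    (hR t' ht U hUm n hn) ?_ hω hρ hmin
  nlinarith [mul_le_mul_of_nonneg_left habs hκ]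

/-- **PRICED interval-filling transport**: «`f σ ≤ M + κ·(E^{src}_{t'₀,U₀,h}(σ) − u₀)` for all TI `σ` with density
in `[n₁,n₂]`», `κ ≥ 0`: every density-`n` (`n ∈ [n₁,n₂]`) sourced minimiser at `(t', U)` (`U ≥ 0`) with canonical
cap `R` has `f ω ≤ M + κ·(R + (16/π²)|t'₀ − t'| + max(U₀ − U, 0)·n/2 − u₀)`. [cite: WangEtAl2024, §III] -/
theorem canonicalMinimiser_le_priced_of_capClass_fillingInterval_tPrime_U {f : InfVolFermionState 2 → ℝ}
    {t'₀ t' U₀ U n₁ n₂ n h u₀ R M κ : ℝ} (hU : 0 ≤ U) (hn₁ : 0 ≤ n₁) (hn₂ : n₂ < 2) (hn : n ∈ Set.Icc n₁ n₂)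
    (hκ : 0 ≤ κ)
    (hW : ∀ σ : InfVolFermionState 2, σ.IsTranslationInvariant → σ.density ∈ Set.Icc n₁ n₂ →
      f σ ≤ M + κ * (σ.meanEnergy (hubbardTTPrimeSourcedInteraction 1 t'₀ U₀ 0 dWaveFormFactor h) 1 - u₀))
    (hR : energyDensityTT' 1 t' U n ≤ R)
    {ω : InfVolFermionState 2} (hω : ω.IsTranslationInvariant) (hρ : ω.density = n)
    (hmin : ∀ ω' : InfVolFermionState 2, ω'.IsTranslationInvariant → ω'.density = n →
      ω.meanEnergy (hubbardTTPrimeSourcedInteraction 1 t' U 0 dWaveFormFactor h) 1 ≤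
        ω'.meanEnergy (hubbardTTPrimeSourcedInteraction 1 t' U 0 dWaveFormFactor h) 1) :
    f ω ≤ M + κ * (R + 16 / Real.pi ^ 2 * |t'₀ - t'| + max (U₀ - U) 0 * (n / 2) - u₀) := by
  have hn0 : 0 ≤ n := hn₁.trans hn.1
  have hn2 : n < 2 := lt_of_le_of_lt hn.2 hn₂
  have h1 := meanEnergy_sourced_le_of_canonicalMinimiser hU hn0 hn2 hmin hR
  have h2 := hω.meanEnergy_sourced_anchor₂_le_kinematic hρ 1 t' U t'₀ U₀ 0 dWaveFormFactor h
  refine (hW ω hω (hρ ▸ hn)).trans ?_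
  nlinarith [mul_le_mul_of_nonneg_left (show ω.meanEnergy (hubbardTTPrimeSourcedInteraction 1 t'₀ U₀ 0 dWaveFormFactor h) 1 - u₀ ≤
    R + 16 / Real.pi ^ 2 * |t'₀ - t'| + max (U₀ - U) 0 * (n / 2) - u₀ by linarith) hκ]

/-- **The pair-amplitude slot, interval-filling menu, `(t', U, n)` cell**: `√2·Re ω(P₀^d) ≤ M̃` for every density-`n`
sourced minimiser at every `(t', U, n) ∈ [s₁,s₂] × [U₀,U₂] × [n₁,n₂]`, from ONE interval-filling node at
`(t'₀, U₀, h)`, a uniform canonical cap `R` on the cell and `R + (16/π²)·max(t'₀ − s₁, s₂ − t'₀) ≤ u`.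
[cite: WangEtAl2024, §III] -/
theorem canonicalMinimiser_sqrtTwo_mul_pairAmp_le_of_menuNode_fillingInterval_cell
    {t'₀ s₁ s₂ U₀ U₂ n₁ n₂ h u R Mt : ℝ} (hU₀ : 0 ≤ U₀) (hn₁ : 0 ≤ n₁) (hn₂ : n₂ < 2)
    (hM : ∀ σ : InfVolFermionState 2, σ.IsTranslationInvariant → σ.density ∈ Set.Icc n₁ n₂ →
      σ.meanEnergy (hubbardTTPrimeSourcedInteraction 1 t'₀ U₀ 0 dWaveFormFactor h) 1 ≤ u →
        Real.sqrt 2 * (σ.expect (pairRegion (insert 0 unitSteps) 0)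
          (localPairAt (insert 0 unitSteps) dWaveFormFactor 0)).re ≤ Mt)
    (hR : ∀ s ∈ Set.Icc s₁ s₂, ∀ V ∈ Set.Icc U₀ U₂, ∀ m ∈ Set.Icc n₁ n₂, energyDensityTT' 1 s V m ≤ R)
    (hslack : R + 16 / Real.pi ^ 2 * max (t'₀ - s₁) (s₂ - t'₀) ≤ u)
    {t' U n : ℝ} (ht : t' ∈ Set.Icc s₁ s₂) (hUm : U ∈ Set.Icc U₀ U₂) (hn : n ∈ Set.Icc n₁ n₂)
    {ω : InfVolFermionState 2} (hω : ω.IsTranslationInvariant) (hρ : ω.density = n)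
    (hmin : ∀ ω' : InfVolFermionState 2, ω'.IsTranslationInvariant → ω'.density = n →
      ω.meanEnergy (hubbardTTPrimeSourcedInteraction 1 t' U 0 dWaveFormFactor h) 1 ≤
        ω'.meanEnergy (hubbardTTPrimeSourcedInteraction 1 t' U 0 dWaveFormFactor h) 1) :
    Real.sqrt 2 * (ω.expect (pairRegion (insert 0 unitSteps) 0)
      (localPairAt (insert 0 unitSteps) dWaveFormFactor 0)).re ≤ Mt :=
  forall_canonicalMinimiser_of_capClass_fillingInterval_cell
    (P := fun σ => Real.sqrt 2 * (σ.expect (pairRegion (insert 0 unitSteps) 0)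
      (localPairAt (insert 0 unitSteps) dWaveFormFactor 0)).re ≤ Mt)
    hU₀ hn₁ hn₂ hM hR hslack ht hUm hn hω hρ hmin

end FillingInterval

/-! ### §8 Joint `(t', U)` WORD form: slope words on the target state replace the kinematic constants -/

section SlopeWords

variable {P : InfVolFermionState 2 → Prop}

/-- **CAP-CLASS TRANSPORT WITH SLOPE WORDS ON THE TARGET STATE**: if the target minimiser `ω` carries words
`(t'₀ − t')·K₂(ω) ≤ c_K` and `(U₀ − U)·D(ω) ≤ c_D` (e.g. from certified `K₂` / double-occupancy windows of the
target's ground-state class), then `R + c_D + c_K ≤ u` suffices for the anchor's class sentence to apply.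
[cite: WangEtAl2024, §III] -/
theorem forall_canonicalMinimiser_of_capClass_of_slopeWords {t'₀ t' U₀ U n h u R cK cD : ℝ} (hU : 0 ≤ U)
    (hn0 : 0 ≤ n) (hn2 : n < 2)
    (hW : ∀ σ : InfVolFermionState 2, σ.IsTranslationInvariant → σ.density = n →
      σ.meanEnergy (hubbardTTPrimeSourcedInteraction 1 t'₀ U₀ 0 dWaveFormFactor h) 1 ≤ u → P σ)
    (hR : energyDensityTT' 1 t' U n ≤ R) (hslack : R + cD + cK ≤ u)
    {ω : InfVolFermionState 2} (hω : ω.IsTranslationInvariant) (hρ : ω.density = n)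
    (hK : (t'₀ - t') * ω.meanEnergy (hubbardTTPrimeFermionInteraction 0 1 0) 1 ≤ cK)
    (hD : (U₀ - U) * ω.meanEnergy (hubbardTTPrimeFermionInteraction 0 0 1) 1 ≤ cD)
    (hmin : ∀ ω' : InfVolFermionState 2, ω'.IsTranslationInvariant → ω'.density = n →
      ω.meanEnergy (hubbardTTPrimeSourcedInteraction 1 t' U 0 dWaveFormFactor h) 1 ≤
        ω'.meanEnergy (hubbardTTPrimeSourcedInteraction 1 t' U 0 dWaveFormFactor h) 1) :
    P ω := by
  have h1 := meanEnergy_sourced_le_of_canonicalMinimiser hU hn0 hn2 hmin hR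
  have h2 := ω.meanEnergy_sourced_affine 1 t' U t'₀ U₀ 0 dWaveFormFactor h
  exact hW ω hω hρ (by linarith)

/-- **Kinematic in `t'`, DOUBLE-OCCUPANCY WORD in `U`** (target below the anchor's `U`, `D(ω) ≤ D⁺` — for the
source-free class a certified docc cap at any lower-`U` node serves, docc being antitone in `U` along ground states):
`R + (16/π²)|t'₀ − t'| + (U₀ − U)·D⁺ ≤ u` suffices. [cite: WangEtAl2024, §III] -/
theorem forall_canonicalMinimiser_of_capClass_tPrime_of_docc_le {t'₀ t' U₀ U n h u R Dp : ℝ} (hU : 0 ≤ U)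
    (hUle : U ≤ U₀) (hn0 : 0 ≤ n) (hn2 : n < 2)
    (hW : ∀ σ : InfVolFermionState 2, σ.IsTranslationInvariant → σ.density = n →
      σ.meanEnergy (hubbardTTPrimeSourcedInteraction 1 t'₀ U₀ 0 dWaveFormFactor h) 1 ≤ u → P σ)
    (hR : energyDensityTT' 1 t' U n ≤ R) (hslack : R + 16 / Real.pi ^ 2 * |t'₀ - t'| + (U₀ - U) * Dp ≤ u)
    {ω : InfVolFermionState 2} (hω : ω.IsTranslationInvariant) (hρ : ω.density = n)
    (hD : ω.meanEnergy (hubbardTTPrimeFermionInteraction 0 0 1) 1 ≤ Dp)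
    (hmin : ∀ ω' : InfVolFermionState 2, ω'.IsTranslationInvariant → ω'.density = n →
      ω.meanEnergy (hubbardTTPrimeSourcedInteraction 1 t' U 0 dWaveFormFactor h) 1 ≤
        ω'.meanEnergy (hubbardTTPrimeSourcedInteraction 1 t' U 0 dWaveFormFactor h) 1) :
    P ω := by
  have h1 := meanEnergy_sourced_le_of_canonicalMinimiser hU hn0 hn2 hmin hR
  have h2 := hω.meanEnergy_sourced_anchor_le_kinematic 1 t' t'₀ U 0 dWaveFormFactor h
  have h3 : ω.meanEnergy (hubbardTTPrimeSourcedInteraction 1 t'₀ U₀ 0 dWaveFormFactor h) 1 ≤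
      ω.meanEnergy (hubbardTTPrimeSourcedInteraction 1 t'₀ U 0 dWaveFormFactor h) 1 + (U₀ - U) * Dp := by
    rw [ω.meanEnergy_sourced_affine 1 t'₀ U t'₀ U₀ 0 dWaveFormFactor h, sub_self, zero_mul, add_zero]
    nlinarith [mul_le_mul_of_nonneg_left hD (sub_nonneg.2 hUle)]
  exact hW ω hω hρ (by linarith)

/-- **PRICED form with slope words**: «`f σ ≤ M + κ·(E^{src}_{t'₀,U₀,h}(σ) − u₀)`», `κ ≥ 0`, words `c_K`, `c_D` on the
target minimiser ⇒ `f ω ≤ M + κ·(R + c_D + c_K − u₀)`. [cite: WangEtAl2024, §III] -/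
theorem canonicalMinimiser_le_priced_of_capClass_of_slopeWords {f : InfVolFermionState 2 → ℝ}
    {t'₀ t' U₀ U n h u₀ R M κ cK cD : ℝ} (hU : 0 ≤ U) (hn0 : 0 ≤ n) (hn2 : n < 2) (hκ : 0 ≤ κ)
    (hW : ∀ σ : InfVolFermionState 2, σ.IsTranslationInvariant → σ.density = n →
      f σ ≤ M + κ * (σ.meanEnergy (hubbardTTPrimeSourcedInteraction 1 t'₀ U₀ 0 dWaveFormFactor h) 1 - u₀))
    (hR : energyDensityTT' 1 t' U n ≤ R)
    {ω : InfVolFermionState 2} (hω : ω.IsTranslationInvariant) (hρ : ω.density = n)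
    (hK : (t'₀ - t') * ω.meanEnergy (hubbardTTPrimeFermionInteraction 0 1 0) 1 ≤ cK)
    (hD : (U₀ - U) * ω.meanEnergy (hubbardTTPrimeFermionInteraction 0 0 1) 1 ≤ cD)
    (hmin : ∀ ω' : InfVolFermionState 2, ω'.IsTranslationInvariant → ω'.density = n →
      ω.meanEnergy (hubbardTTPrimeSourcedInteraction 1 t' U 0 dWaveFormFactor h) 1 ≤
        ω'.meanEnergy (hubbardTTPrimeSourcedInteraction 1 t' U 0 dWaveFormFactor h) 1) :
    f ω ≤ M + κ * (R + cD + cK - u₀) := by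
  have h1 := meanEnergy_sourced_le_of_canonicalMinimiser hU hn0 hn2 hmin hR
  have h2 := ω.meanEnergy_sourced_affine 1 t' U t'₀ U₀ 0 dWaveFormFactor h
  refine (hW ω hω hρ).trans ?_
  nlinarith [mul_le_mul_of_nonneg_left (show ω.meanEnergy (hubbardTTPrimeSourcedInteraction 1 t'₀ U₀ 0 dWaveFormFactor h) 1 - u₀ ≤
    R + cD + cK - u₀ by linarith) hκ]

end SlopeWords

/-! ### §9 The other direction: a TRIAL-STATE cap certified at the anchor, read at the target `t'`
(the sourced CAP rows of the response-floor chords move along `t'` exactly with the trial state's own `K₂`) -/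

namespace InfVolFermionState

/-- **Exact transport of a trial state's sourced energy along `t'`**: if `K₂(σ) = k` then
`E^{src}_{t'}(σ) = E^{src}_{t'₀}(σ) + (t' − t'₀)·k` — for an explicit (cluster / product) trial state `k` is one
more exact rational of the producer, so a cap row `E^{src}_{t'₀,h}(σ) ≤ u` certified at the anchor IS the cap row
`E^{src}_{t',h}(σ) ≤ u + (t' − t'₀)k` at every `t'`. [cite: Israel1979, Thm. I.3.4] -/
theorem meanEnergy_sourced_eq_anchor_add_of_diagHop_eq (σ : InfVolFermionState 2) {k : ℝ}
    (hk : σ.meanEnergy (hubbardTTPrimeFermionInteraction 0 1 0) 1 = k) (t t' t'₀ U μ : ℝ) (g : Site 2 → ℝ)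
    (h : ℝ) :
    σ.meanEnergy (hubbardTTPrimeSourcedInteraction t t' U μ g h) 1 =
      σ.meanEnergy (hubbardTTPrimeSourcedInteraction t t'₀ U μ g h) 1 + (t' - t'₀) * k := by
  rw [σ.meanEnergy_sourced_tp_affine t t'₀ t' U μ g h, hk]

/-- **Trial cap at the target from a cap at the anchor and a two-sided `K₂` word on the trial state**:
`E^{src}_{t'₀}(σ) ≤ u`, `(t' − t'₀)·K₂(σ) ≤ c` ⇒ `E^{src}_{t'}(σ) ≤ u + c`. [cite: Israel1979, Thm. I.3.4] -/
theorem meanEnergy_sourced_le_of_anchorCap_of_diagHop_word (σ : InfVolFermionState 2) {t' t'₀ u c : ℝ}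
    {t U μ : ℝ} {g : Site 2 → ℝ} {h : ℝ}
    (hu : σ.meanEnergy (hubbardTTPrimeSourcedInteraction t t'₀ U μ g h) 1 ≤ u)
    (hc : (t' - t'₀) * σ.meanEnergy (hubbardTTPrimeFermionInteraction 0 1 0) 1 ≤ c) :
    σ.meanEnergy (hubbardTTPrimeSourcedInteraction t t' U μ g h) 1 ≤ u + c := by
  rw [σ.meanEnergy_sourced_tp_affine t t'₀ t' U μ g h]
  linarith

/-- **Kinematic trial cap at the target** for a translation-invariant trial state:
`E^{src}_{t'}(σ) ≤ u + (16/π²)|t' − t'₀|`. [cite: LiebLoss1993, §8, Theorem 8.2] -/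
theorem IsTranslationInvariant.meanEnergy_sourced_le_of_anchorCap_kinematic {σ : InfVolFermionState 2}
    (hσ : σ.IsTranslationInvariant) {t' t'₀ u : ℝ} {t U μ : ℝ} {g : Site 2 → ℝ} {h : ℝ}
    (hu : σ.meanEnergy (hubbardTTPrimeSourcedInteraction t t'₀ U μ g h) 1 ≤ u) :
    σ.meanEnergy (hubbardTTPrimeSourcedInteraction t t' U μ g h) 1 ≤ u + 16 / Real.pi ^ 2 * |t' - t'₀| := by
  have h1 := hσ.meanEnergy_sourced_anchor_le_kinematic t t'₀ t' U μ g h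
  linarith

/-- **The inhabited-class form the chord-floor readers take**: a TI density-`n` trial state with anchor cap `u`
and `K₂`-word `c` witnesses `∃ σ TI, density n, E^{src}_{t',h}(σ) ≤ u + c` at the target, hence every density-`n`
sourced minimiser at `(t', h)` lies below `u + c`. [cite: Israel1979, Thm. I.3.4] -/
theorem meanEnergy_sourced_minimiser_le_of_trial_anchorCap {t' t'₀ U n h u c : ℝ} {σ : InfVolFermionState 2}
    (hσ : σ.IsTranslationInvariant) (hσρ : σ.density = n)
    (hu : σ.meanEnergy (hubbardTTPrimeSourcedInteraction 1 t'₀ U 0 dWaveFormFactor h) 1 ≤ u)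
    (hc : (t' - t'₀) * σ.meanEnergy (hubbardTTPrimeFermionInteraction 0 1 0) 1 ≤ c)
    {ω : InfVolFermionState 2}
    (hmin : ∀ ω' : InfVolFermionState 2, ω'.IsTranslationInvariant → ω'.density = n →
      ω.meanEnergy (hubbardTTPrimeSourcedInteraction 1 t' U 0 dWaveFormFactor h) 1 ≤
        ω'.meanEnergy (hubbardTTPrimeSourcedInteraction 1 t' U 0 dWaveFormFactor h) 1) :
    ω.meanEnergy (hubbardTTPrimeSourcedInteraction 1 t' U 0 dWaveFormFactor h) 1 ≤ u + c :=
  (hmin σ hσ hσρ).trans (σ.meanEnergy_sourced_le_of_anchorCap_of_diagHop_word hu hc)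

/-- **RESPONSE FLOOR AT THE TARGET `t'` from a canonical source-free FLOOR at the target and a TRIAL CAP moved from
the anchor**: for a density-`n` (`0 < n < 2`) sourced minimiser `ω` at `(t', U, h)`, `U ≥ 0`, `h > 0`, a canonical
floor `L ≤ e(1,t',U;n)` and a TI density-`n` trial state `σ` with `E^{src}_{t'₀,h}(σ) ≤ u`,
`(t' − t'₀)·K₂(σ) ≤ c`: `(L − u − c)/h ≤ e_P(ω) = 2·Re ω(P₀^d)` (Griffiths' chord between the source-free floor and
the sourced cap, both now at the target). [cite: Griffiths1966, §II] -/
theorem div_le_pairAmplitude_minimiser_of_canonicalFloor_of_trial_anchorCap {t' t'₀ U n h u c L : ℝ}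
    (hU : 0 ≤ U) (hn0 : 0 < n) (hn2 : n < 2) (hh : 0 < h) (hL : L ≤ energyDensityTT' 1 t' U n)
    {σ : InfVolFermionState 2} (hσ : σ.IsTranslationInvariant) (hσρ : σ.density = n)
    (hu : σ.meanEnergy (hubbardTTPrimeSourcedInteraction 1 t'₀ U 0 dWaveFormFactor h) 1 ≤ u)
    (hc : (t' - t'₀) * σ.meanEnergy (hubbardTTPrimeFermionInteraction 0 1 0) 1 ≤ c)
    {ω : InfVolFermionState 2} (hω : ω.IsTranslationInvariant) (hρ : ω.density = n)
    (hmin : ∀ ω' : InfVolFermionState 2, ω'.IsTranslationInvariant → ω'.density = n →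
      ω.meanEnergy (hubbardTTPrimeSourcedInteraction 1 t' U 0 dWaveFormFactor h) 1 ≤
        ω'.meanEnergy (hubbardTTPrimeSourcedInteraction 1 t' U 0 dWaveFormFactor h) 1) :
    (L - (u + c)) / h ≤ ω.meanEnergy (pairSourceInteraction dWaveFormFactor) 1 := by
  have hcap := meanEnergy_sourced_minimiser_le_of_trial_anchorCap hσ hσρ hu hc hmin
  have hρ0 : 0 < ω.density := by rw [hρ]; exact hn0
  have hρ2 : ω.density < 2 := by rw [hρ]; exact hn2
  have hfloor : L ≤ ω.meanEnergy (hubbardTTPrimeSourcedInteraction 1 t' U 0 dWaveFormFactor (h - h)) 1 := by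
    rw [sub_self, meanEnergy_hubbardTTPrimeSourced, zero_mul, sub_zero, zero_mul, sub_zero]
    have hv := hω.energyDensityTT'_le_meanEnergy 1 t' hU hρ0 hρ2
    rw [hρ] at hv
    exact hL.trans hv
  exact ω.div_le_pairAmplitude_of_bounds hh hfloor hcap

end InfVolFermionState


/-! ### §10 Row-free DOUBLE-OCCUPANCY words for low-energy translation-invariant states — the downward-`U` price of a cell -/

namespace InfVolFermionState

/-- **`a·K₂(σ) ≤ (16/π²)|a|` for every translation-invariant `σ`** (the filling-free `K₂` row, signed form).
[cite: LiebLoss1993, §8, Theorem 8.2] -/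
theorem IsTranslationInvariant.mul_meanEnergy_diagHop_le_kinematic {σ : InfVolFermionState 2} (hσ : σ.IsTranslationInvariant)
    (a : ℝ) : a * σ.meanEnergy (hubbardTTPrimeFermionInteraction 0 1 0) 1 ≤ 16 / Real.pi ^ 2 * |a| := by
  have h2 := hσ.abs_meanEnergy_diagHop_le_of_any_density
  have h4 : a * σ.meanEnergy (hubbardTTPrimeFermionInteraction 0 1 0) 1 ≤
      |a| * |σ.meanEnergy (hubbardTTPrimeFermionInteraction 0 1 0) 1| := by
    rw [← abs_mul]; exact le_abs_self _
  nlinarith [mul_le_mul_of_nonneg_left h2 (abs_nonneg a)]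

/-- **The hopping energy of a translation-invariant state is `≥ −(16/π²)(1 + |t'|)`** (both filling-free kinematic rows `|K₁|, |K₂| ≤ 16/π²`):
`e_{Φ(1,t',0)}(σ) ≥ −(16/π²)(1 + |t'|)`. [cite: LiebLoss1993, §8, Theorem 8.2] -/
theorem IsTranslationInvariant.meanEnergy_hopping_ge_kinematic {σ : InfVolFermionState 2} (hσ : σ.IsTranslationInvariant)
    (t' : ℝ) : -(16 / Real.pi ^ 2 * (1 + |t'|)) ≤ σ.meanEnergy (hubbardTTPrimeFermionInteraction 1 t' 0) 1 := by
  have haff : σ.meanEnergy (hubbardTTPrimeFermionInteraction 1 t' 0) 1 =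
      σ.meanEnergy (hubbardTTPrimeFermionInteraction 1 0 0) 1 + t' * σ.meanEnergy (hubbardTTPrimeFermionInteraction 0 1 0) 1 := by
    rw [σ.meanEnergy_hubbardTTPrime_affine 1 0 0 t' 0]; ring
  have hK1 := hσ.abs_meanEnergy_nnHop_le_of_any_density
  have hK2 := hσ.mul_meanEnergy_diagHop_le_kinematic (-t')
  rw [abs_neg] at hK2
  have hK1' := neg_abs_le (σ.meanEnergy (hubbardTTPrimeFermionInteraction 1 0 0) 1)
  rw [haff]
  nlinarith

/-- **ROW-FREE DOUBLE-OCCUPANCY CAP FOR A LOW-ENERGY TRANSLATION-INVARIANT STATE**: if `e_{Φ(1,t',U)}(σ) ≤ R` (`U > 0`) then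
`D(σ) ≤ (R + (16/π²)(1 + |t'|))/U` — the interaction energy is the total minus the hopping part, and the hopping part is kinematically
floored. (At `(8, 7/8, −1/4)` with `R = hi₄₄₅`: `D ≤ 0.17`, versus the class bound `n/2 = 0.4375`.) [cite: Ruelle1969, §3.4] -/
theorem IsTranslationInvariant.docc_le_of_meanEnergy_le_kinematic {σ : InfVolFermionState 2} (hσ : σ.IsTranslationInvariant)
    {t' U R : ℝ} (hU : 0 < U) (hE : σ.meanEnergy (hubbardTTPrimeFermionInteraction 1 t' U) 1 ≤ R) :
    σ.meanEnergy (hubbardTTPrimeFermionInteraction 0 0 1) 1 ≤ (R + 16 / Real.pi ^ 2 * (1 + |t'|)) / U := by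
  have haff : σ.meanEnergy (hubbardTTPrimeFermionInteraction 1 t' U) 1 =
      σ.meanEnergy (hubbardTTPrimeFermionInteraction 1 t' 0) 1 + U * σ.meanEnergy (hubbardTTPrimeFermionInteraction 0 0 1) 1 := by
    rw [σ.meanEnergy_hubbardTTPrime_affine 1 t' 0 t' U]; ring
  have hhop := hσ.meanEnergy_hopping_ge_kinematic t'
  rw [le_div_iff₀ hU]
  nlinarith

/-- **`U`-SECANT DOUBLE-OCCUPANCY CAP from a canonical FLOOR at a smaller coupling**: for a translation-invariant `σ` of density
`ρ ∈ (0,2)` with `e_{Φ(1,t',U)}(σ) ≤ R`, a certified floor `L ≤ e(1,t',U';ρ)` at `0 ≤ U' < U` gives `D(σ) ≤ (R − L)/(U − U')`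
(variational principle at `U'`: `e(1,t',U';ρ) ≤ e_{Φ(1,t',U')}(σ) = e_{Φ(1,t',U)}(σ) − (U − U')·D(σ)`). [cite: Ruelle1969, §3.4] -/
theorem IsTranslationInvariant.docc_le_secant_of_meanEnergy_le {σ : InfVolFermionState 2} (hσ : σ.IsTranslationInvariant)
    {t' U U' R L : ℝ} (hU' : 0 ≤ U') (hlt : U' < U) (hρ0 : 0 < σ.density) (hρ2 : σ.density < 2)
    (hE : σ.meanEnergy (hubbardTTPrimeFermionInteraction 1 t' U) 1 ≤ R) (hL : L ≤ energyDensityTT' 1 t' U' σ.density) :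
    σ.meanEnergy (hubbardTTPrimeFermionInteraction 0 0 1) 1 ≤ (R - L) / (U - U') := by
  have haff : σ.meanEnergy (hubbardTTPrimeFermionInteraction 1 t' U) 1 =
      σ.meanEnergy (hubbardTTPrimeFermionInteraction 1 t' U') 1 +
        (U - U') * σ.meanEnergy (hubbardTTPrimeFermionInteraction 0 0 1) 1 := by
    rw [σ.meanEnergy_hubbardTTPrime_affine 1 t' U' t' U]; ring
  have hvar := hσ.energyDensityTT'_le_meanEnergy 1 t' hU' hρ0 hρ2
  rw [le_div_iff₀ (sub_pos.2 hlt)]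
  nlinarith

end InfVolFermionState

/-- **A density-`n` ground-state-class minimiser (field `h = 0`, chemical-potential slot `0`) lies below the canonical cap in the plain
`t–t'` energy**: `e_{Φ(1,t',U)}(ω) ≤ R`. [cite: Ruelle1969, §3.4] -/
theorem meanEnergy_hubbardTTPrime_le_of_canonicalMinimiser_zeroField {t' U n R : ℝ} (hU : 0 ≤ U) (hn0 : 0 ≤ n) (hn2 : n < 2)
    {ω : InfVolFermionState 2}
    (hmin : ∀ ω' : InfVolFermionState 2, ω'.IsTranslationInvariant → ω'.density = n →
      ω.meanEnergy (hubbardTTPrimeSourcedInteraction 1 t' U 0 dWaveFormFactor 0) 1 ≤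
        ω'.meanEnergy (hubbardTTPrimeSourcedInteraction 1 t' U 0 dWaveFormFactor 0) 1)
    (hR : energyDensityTT' 1 t' U n ≤ R) :
    ω.meanEnergy (hubbardTTPrimeFermionInteraction 1 t' U) 1 ≤ R := by
  have h1 := meanEnergy_sourced_le_of_canonicalMinimiser hU hn0 hn2 hmin hR
  rw [InfVolFermionState.meanEnergy_hubbardTTPrimeSourced] at h1
  simpa using h1

/-- **PRICED `(t', U)` TRANSPORT FOR THE GROUND-STATE CLASS (`h = 0`) WITH THE ROW-FREE DOCC CAP**: target `(t', U)` with
`0 < U ≤ U₀`, canonical cap `e(1,t',U;n) ≤ R`, priced class sentence at `(t'₀, U₀, 0)`, `κ ≥ 0` ⇒ every density-`n` translation-invariant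
ground state `ω` at `(t', U)` has `f ω ≤ M + κ·(R + (16/π²)|t'₀ − t'| + (U₀ − U)·(R + (16/π²)(1 + |t'|))/U − u₀)` — the downward-`U`
price `(U₀ − U)·n/2` of `…_tPrime_U` replaced by `(U₀ − U)·(R + (16/π²)(1+|t'|))/U`. [cite: WangEtAl2024, §III] -/
theorem groundStateMinimiser_le_priced_of_capClass_tPrime_U_doccKinematic {f : InfVolFermionState 2 → ℝ}
    {t'₀ t' U₀ U n u₀ R M κ : ℝ} (hU : 0 < U) (hUle : U ≤ U₀) (hn0 : 0 ≤ n) (hn2 : n < 2) (hκ : 0 ≤ κ)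
    (hW : ∀ σ : InfVolFermionState 2, σ.IsTranslationInvariant → σ.density = n →
      f σ ≤ M + κ * (σ.meanEnergy (hubbardTTPrimeSourcedInteraction 1 t'₀ U₀ 0 dWaveFormFactor 0) 1 - u₀))
    (hR : energyDensityTT' 1 t' U n ≤ R)
    {ω : InfVolFermionState 2} (hω : ω.IsTranslationInvariant) (hρ : ω.density = n)
    (hmin : ∀ ω' : InfVolFermionState 2, ω'.IsTranslationInvariant → ω'.density = n →
      ω.meanEnergy (hubbardTTPrimeSourcedInteraction 1 t' U 0 dWaveFormFactor 0) 1 ≤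
        ω'.meanEnergy (hubbardTTPrimeSourcedInteraction 1 t' U 0 dWaveFormFactor 0) 1) :
    f ω ≤ M + κ * (R + 16 / Real.pi ^ 2 * |t'₀ - t'| + (U₀ - U) * ((R + 16 / Real.pi ^ 2 * (1 + |t'|)) / U) - u₀) := by
  have hE := meanEnergy_hubbardTTPrime_le_of_canonicalMinimiser_zeroField hU.le hn0 hn2 hmin hR
  have hD := hω.docc_le_of_meanEnergy_le_kinematic hU hE
  have hK := hω.mul_meanEnergy_diagHop_le_kinematic (t'₀ - t')
  have hDc : (U₀ - U) * ω.meanEnergy (hubbardTTPrimeFermionInteraction 0 0 1) 1 ≤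
      (U₀ - U) * ((R + 16 / Real.pi ^ 2 * (1 + |t'|)) / U) := mul_le_mul_of_nonneg_left hD (sub_nonneg.2 hUle)
  have key := canonicalMinimiser_le_priced_of_capClass_of_slopeWords (f := f) hU.le hn0 hn2 hκ hW hR hω hρ hK hDc hmin
  have : M + κ * (R + (U₀ - U) * ((R + 16 / Real.pi ^ 2 * (1 + |t'|)) / U) + 16 / Real.pi ^ 2 * |t'₀ - t'| - u₀) =
      M + κ * (R + 16 / Real.pi ^ 2 * |t'₀ - t'| + (U₀ - U) * ((R + 16 / Real.pi ^ 2 * (1 + |t'|)) / U) - u₀) := by ring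
  rw [this] at key
  exact key

/-- **PRICED `(t', U)` TRANSPORT FOR THE GROUND-STATE CLASS WITH A `U`-SECANT DOCC CAP** (floor `L ≤ e(1,t',U';n)` at `0 ≤ U' < U ≤ U₀`,
`0 < n < 2`): `f ω ≤ M + κ·(R + (16/π²)|t'₀ − t'| + (U₀ − U)·(R − L)/(U − U') − u₀)`. [cite: WangEtAl2024, §III] -/
theorem groundStateMinimiser_le_priced_of_capClass_tPrime_U_doccSecant {f : InfVolFermionState 2 → ℝ}
    {t'₀ t' U₀ U U' n u₀ R L M κ : ℝ} (hU' : 0 ≤ U') (hlt : U' < U) (hUle : U ≤ U₀) (hn0 : 0 < n) (hn2 : n < 2) (hκ : 0 ≤ κ)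
    (hW : ∀ σ : InfVolFermionState 2, σ.IsTranslationInvariant → σ.density = n →
      f σ ≤ M + κ * (σ.meanEnergy (hubbardTTPrimeSourcedInteraction 1 t'₀ U₀ 0 dWaveFormFactor 0) 1 - u₀))
    (hR : energyDensityTT' 1 t' U n ≤ R) (hL : L ≤ energyDensityTT' 1 t' U' n)
    {ω : InfVolFermionState 2} (hω : ω.IsTranslationInvariant) (hρ : ω.density = n)
    (hmin : ∀ ω' : InfVolFermionState 2, ω'.IsTranslationInvariant → ω'.density = n →
      ω.meanEnergy (hubbardTTPrimeSourcedInteraction 1 t' U 0 dWaveFormFactor 0) 1 ≤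
        ω'.meanEnergy (hubbardTTPrimeSourcedInteraction 1 t' U 0 dWaveFormFactor 0) 1) :
    f ω ≤ M + κ * (R + 16 / Real.pi ^ 2 * |t'₀ - t'| + (U₀ - U) * ((R - L) / (U - U')) - u₀) := by
  have hU : 0 ≤ U := hU'.trans hlt.le
  have hE := meanEnergy_hubbardTTPrime_le_of_canonicalMinimiser_zeroField hU hn0.le hn2 hmin hR
  have hρ0 : 0 < ω.density := by rw [hρ]; exact hn0
  have hρ2 : ω.density < 2 := by rw [hρ]; exact hn2
  have hL' : L ≤ energyDensityTT' 1 t' U' ω.density := by rw [hρ]; exact hL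
  have hD := hω.docc_le_secant_of_meanEnergy_le hU' hlt hρ0 hρ2 hE hL'
  have hK := hω.mul_meanEnergy_diagHop_le_kinematic (t'₀ - t')
  have hDc : (U₀ - U) * ω.meanEnergy (hubbardTTPrimeFermionInteraction 0 0 1) 1 ≤ (U₀ - U) * ((R - L) / (U - U')) :=
    mul_le_mul_of_nonneg_left hD (sub_nonneg.2 hUle)
  have key := canonicalMinimiser_le_priced_of_capClass_of_slopeWords (f := f) hU hn0.le hn2 hκ hW hR hω hρ hK hDc hmin
  have : M + κ * (R + (U₀ - U) * ((R - L) / (U - U')) + 16 / Real.pi ^ 2 * |t'₀ - t'| - u₀) =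
      M + κ * (R + 16 / Real.pi ^ 2 * |t'₀ - t'| + (U₀ - U) * ((R - L) / (U - U')) - u₀) := by ring
  rw [this] at key
  exact key

end Literature.MathematicalPhysics.QuantumLattice

end
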